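import Summits.Ventures.PercRepro.Night2FatZSix

/-!
# night-2: the two-planes regime — counting the targets that contain a cross pair; `N = 7`

* **`choose_le_card_filter_meets_both`**: inclusion–exclusion for the `k`-subsets of `W` meeting two given subsets `A`, `B`:
  `C(|W|, k) + C(|W ∖ (A ∪ B)|, k) ≤ #{Y : meets both} + C(|W ∖ A|, k) + C(|W ∖ B|, k)`;
* **`fat_count_level_ge_cross`**: in the non-degenerate two-planes regime the level-`j` sum over the unloaded targets above
  `Q ∪ {x}` is at least (that count, with `W = W ∖ {x}`, `A`, `B` the points of `W ∖ {x}` in the two planes off the spine)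
  times `fatTerm j c_j` — every target containing a cross pair is unloaded (`dload_eq_zero_of_cross_pair`);
* **`basis_pair_fair_fat_of_two_planes_seven`**: at `N = 7` with `|L ∩ H₀| ≤ 4`, one point of `W ∖ {x}` in each plane off
  the spine and four off the spine in all, level `1`, the cross targets of levels `3, 4` and the whole levels `5, 6, 7`
  give the fair share (the minimum `1.025` at the split `3 + 1`).
Paper `proofs/NIGHT-2-g34.md` §6 (c).
-/

namespace PercRepro.Shadow

open PercRepro.ThmH PercRepro.PerFlat

variable {α : Type*} [DecidableEq α] {M : Matroid α} [M.Finite] {G : Finset α}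

/-- **Inclusion–exclusion for the `k`-subsets meeting two sets.** -/
theorem choose_le_card_filter_meets_both (W A B : Finset α) (k : ℕ) :
    W.card.choose k + (W \ (A ∪ B)).card.choose k ≤
      ((W.powersetCard k).filter (fun Y => (Y ∩ A).Nonempty ∧ (Y ∩ B).Nonempty)).card +
        (W \ A).card.choose k + (W \ B).card.choose k := by
  set P := W.powersetCard k with hP
  set PA := P.filter (fun Y => ¬ (Y ∩ A).Nonempty) with hPA
  set PB := P.filter (fun Y => ¬ (Y ∩ B).Nonempty) with hPB
  have hmeet : P.filter (fun Y => (Y ∩ A).Nonempty ∧ (Y ∩ B).Nonempty) = P \ (PA ∪ PB) := by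
    ext Y
    simp only [hPA, hPB, Finset.mem_filter, Finset.mem_sdiff, Finset.mem_union, not_or, not_and, not_not]
    tauto
  have hsub : PA ∪ PB ⊆ P := Finset.union_subset (Finset.filter_subset _ _) (Finset.filter_subset _ _)
  have h1 := Finset.card_sdiff_add_card_eq_card hsub
  have h2 := Finset.card_union_add_card_inter PA PB
  have hA : PA ⊆ (W \ A).powersetCard k := by
    intro Y hY
    rw [hPA, Finset.mem_filter, hP, Finset.mem_powersetCard] at hY
    rw [Finset.mem_powersetCard]
    refine ⟨?_, hY.1.2⟩
    intro y hy
    rw [Finset.mem_sdiff]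
    refine ⟨hY.1.1 hy, fun hyA => hY.2 ⟨y, Finset.mem_inter.2 ⟨hy, hyA⟩⟩⟩
  have hB : PB ⊆ (W \ B).powersetCard k := by
    intro Y hY
    rw [hPB, Finset.mem_filter, hP, Finset.mem_powersetCard] at hY
    rw [Finset.mem_powersetCard]
    refine ⟨?_, hY.1.2⟩
    intro y hy
    rw [Finset.mem_sdiff]
    refine ⟨hY.1.1 hy, fun hyB => hY.2 ⟨y, Finset.mem_inter.2 ⟨hy, hyB⟩⟩⟩
  have hAB : (W \ (A ∪ B)).powersetCard k ⊆ PA ∩ PB := by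
    intro Y hY
    rw [Finset.mem_powersetCard] at hY
    have hYW : Y ⊆ W := hY.1.trans Finset.sdiff_subset
    rw [Finset.mem_inter, hPA, hPB, Finset.mem_filter, Finset.mem_filter, hP, Finset.mem_powersetCard]
    refine ⟨⟨⟨hYW, hY.2⟩, ?_⟩, ⟨⟨hYW, hY.2⟩, ?_⟩⟩
    · rintro ⟨y, hy⟩
      rw [Finset.mem_inter] at hy
      exact (Finset.mem_sdiff.1 (hY.1 hy.1)).2 (Finset.mem_union_left _ hy.2)
    · rintro ⟨y, hy⟩
      rw [Finset.mem_inter] at hy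
      exact (Finset.mem_sdiff.1 (hY.1 hy.1)).2 (Finset.mem_union_right _ hy.2)
  have h3 := Finset.card_le_card hA
  have h4 := Finset.card_le_card hB
  have h5 := Finset.card_le_card hAB
  rw [Finset.card_powersetCard] at h3 h4 h5
  rw [hmeet]
  have hPc : P.card = W.card.choose k := Finset.card_powersetCard k W
  omega

/-- **The level-`j` sum over the unloaded targets above `Q ∪ {x}` dominates the count of the `(j − 1)`-subsets of `W ∖ {x}`
meeting both planes off the spine**, each worth `fatTerm j c_j` (non-degenerate two-planes regime). -/
theorem fat_count_level_ge_cross (hG : G ∈ flatsQ M (5 + 1)) (hd : (gr M \ G).card = 2)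
    (hk : kColoops M G = 1) (hs : ∀ e ∈ gr M, ∀ f ∈ gr M, e ≠ f → rkN M {e, f} = 2)
    (hl : ∀ e ∈ gr M, M.Indep {e}) (hfat : (fatClosures M 5 G 2).card ≤ 1) {B₀ : Finset α}
    (hB₀ : B₀ ∈ thinMembers M 5 G) {w₀ x : α} (hD : G \ clF M B₀ = {w₀, x}) {R₁ : Finset α}
    (hR₁V : R₁ ⊆ (G \ coloops M G) \ {w₀, x}) (hR₁2 : rkN M R₁ = 2) (hR₁3 : 3 ≤ R₁.card) {c₂ c₃ : α}
    (hc₂V : c₂ ∈ (G \ coloops M G) \ {w₀, x}) (hc₃V : c₃ ∈ (G \ coloops M G) \ {w₀, x})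
    (hc₂ : c₂ ∉ clF M R₁) (hc₃ : c₃ ∉ clF M (insert c₂ R₁))
    (hcover : ∀ e ∈ (G \ coloops M G) \ {w₀, x}, e ∈ clF M (insert c₂ R₁) ∨ e ∈ clF M (insert c₃ R₁))
    (hnd₂ : 3 ≤ rkN M (((G \ coloops M G) \ {w₀, x}).filter
      (fun e => e ∈ clF M (insert c₂ R₁) ∧ e ∉ clF M R₁)))
    (hnd₃ : 3 ≤ rkN M (((G \ coloops M G) \ {w₀, x}).filter
      (fun e => e ∈ clF M (insert c₃ R₁) ∧ e ∉ clF M R₁)))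
    {B : Finset α} (hB : B ∈ thinMembers M 5 G) (hnP : ¬ bigP M G B) {z : α} (hz : z ∈ G \ clF M B)
    (hx : x ∈ G \ insert z B) {j : ℕ} (hj : 1 ≤ j) :
    (((((G \ insert z B).erase x).powersetCard (j - 1)).filter (fun Y =>
      (Y ∩ (((G \ insert z B).erase x).filter (fun e => e ∈ clF M (insert c₂ R₁) ∧ e ∉ clF M R₁))).Nonempty ∧
      (Y ∩ (((G \ insert z B).erase x).filter (fun e => e ∈ clF M (insert c₃ R₁) ∧ e ∉ clF M R₁))).Nonempty)).card : ℚ) *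
      fatTerm j (if (G \ insert z B).card - j ≤ 3 then 1 else 11 / 18) ≤
      ∑ T ∈ ((tgtSets M 5 G B z).filter
        (fun T => x ∈ T ∧ dload M 5 G (bigP M G) (dshGT2 M 5 G) T = 0)).filter
        (fun T => (T \ insert z B).card = j),
        capS M 5 G T / ((221 / 360 : ℚ) * ((2 * ((T \ coloops M G).card - 2).choose 4 : ℕ) : ℚ)) := by
  have hd' : (gr M \ G).card ≤ 5 := by omega
  have hBm : B ∈ membersIn M (Uq M (5 + 2) 5) G := (mem_thinMembers.1 hB).1
  have hxQ : x ∉ insert z B := (Finset.mem_sdiff.1 hx).2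
  set W' := (G \ insert z B).erase x with hW'
  set A := W'.filter (fun e => e ∈ clF M (insert c₂ R₁) ∧ e ∉ clF M R₁) with hA
  set Bp := W'.filter (fun e => e ∈ clF M (insert c₃ R₁) ∧ e ∉ clF M R₁) with hBp
  set S := (W'.powersetCard (j - 1)).filter (fun Y => (Y ∩ A).Nonempty ∧ (Y ∩ Bp).Nonempty) with hS
  set F := ((tgtSets M 5 G B z).filter
    (fun T => x ∈ T ∧ dload M 5 G (bigP M G) (dshGT2 M 5 G) T = 0)).filter
    (fun T => (T \ insert z B).card = j) with hF
  -- the map `Y ↦ Q ∪ ({x} ∪ Y)` sends `S` injectively into `F`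
  have hmaps : ∀ Y ∈ S, insert z B ∪ ({x} ∪ Y) ∈ F := by
    intro Y hY
    rw [hS, Finset.mem_filter, Finset.mem_powersetCard] at hY
    obtain ⟨⟨hYW, hYc⟩, ⟨y₂, hy₂⟩, ⟨y₃, hy₃⟩⟩ := hY
    rw [Finset.mem_inter] at hy₂ hy₃
    have hXY : {x} ∪ Y ⊆ G \ insert z B :=
      Finset.union_subset (Finset.singleton_subset_iff.2 hx) (hYW.trans (Finset.erase_subset _ _))
    have hxY : x ∉ Y := fun h' => (Finset.mem_erase.1 (hYW h')).1 rfl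
    have hcard : ({x} ∪ Y).card = j := by
      rw [Finset.card_union_of_disjoint (Finset.disjoint_singleton_left.2 hxY), Finset.card_singleton, hYc]
      omega
    have hTt : insert z B ∪ ({x} ∪ Y) ∈ tgtSets M 5 G B z := by
      rw [tgtSets_eq_image hG hBm hz, Finset.mem_image]
      exact ⟨{x} ∪ Y, Finset.mem_filter.2 ⟨Finset.mem_powerset.2 hXY, ⟨x, Finset.mem_union_left _ (Finset.mem_singleton_self _)⟩⟩, rfl⟩
    have hsd : (insert z B ∪ ({x} ∪ Y)) \ insert z B = {x} ∪ Y := by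
      rw [Finset.union_sdiff_left]
      exact Finset.sdiff_eq_self_of_disjoint (Finset.disjoint_of_subset_left hXY Finset.sdiff_disjoint)
    have hxT : x ∈ insert z B ∪ ({x} ∪ Y) :=
      Finset.mem_union_right _ (Finset.mem_union_left _ (Finset.mem_singleton_self _))
    have hmemY : ∀ y ∈ Y, y ∈ ((insert z B ∪ ({x} ∪ Y)) \ insert z B).erase x := by
      intro y hy
      rw [hsd]
      exact Finset.mem_erase.2 ⟨fun h' => hxY (h' ▸ hy), Finset.mem_union_right _ hy⟩
    have hload := dload_eq_zero_of_cross_pair hG hd hk hs hl hfat hB₀ hD hR₁V hR₁2 hR₁3 hc₂V hc₃V hc₂ hc₃ hcover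
      hnd₂ hnd₃ hB hnP hz hxQ hTt hxT (hmemY y₂ hy₂.1) (hmemY y₃ hy₃.1)
      (Finset.mem_filter.1 hy₂.2).2.1 (Finset.mem_filter.1 hy₂.2).2.2
      (Finset.mem_filter.1 hy₃.2).2.1 (Finset.mem_filter.1 hy₃.2).2.2
    rw [hF, Finset.mem_filter, Finset.mem_filter]
    refine ⟨⟨hTt, hxT, hload⟩, ?_⟩
    rw [hsd, hcard]
  have hinj : Set.InjOn (fun Y => insert z B ∪ ({x} ∪ Y)) (S : Set (Finset α)) := by
    intro Y₁ hY₁ Y₂ hY₂ heq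
    rw [Finset.mem_coe, hS, Finset.mem_filter, Finset.mem_powersetCard] at hY₁ hY₂
    have key : ∀ Y, Y ⊆ W' → ((insert z B ∪ ({x} ∪ Y)) \ insert z B).erase x = Y := by
      intro Y hYW
      have hXY : {x} ∪ Y ⊆ G \ insert z B :=
        Finset.union_subset (Finset.singleton_subset_iff.2 hx) (hYW.trans (Finset.erase_subset _ _))
      have hxY : x ∉ Y := fun h' => (Finset.mem_erase.1 (hYW h')).1 rfl
      rw [Finset.union_sdiff_left, Finset.sdiff_eq_self_of_disjoint
        (Finset.disjoint_of_subset_left hXY Finset.sdiff_disjoint)]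
      ext e
      simp only [Finset.mem_erase, Finset.mem_union, Finset.mem_singleton]
      constructor
      · rintro ⟨hex, h | h⟩
        · exact absurd h hex
        · exact h
      · intro he
        exact ⟨fun h' => hxY (h' ▸ he), Or.inr he⟩
    have h1 := key Y₁ hY₁.1.1
    have h2 := key Y₂ hY₂.1.1
    simp only at heq
    rw [← h1, ← h2, heq]
  have hcount : S.card ≤ F.card := Finset.card_le_card_of_injOn _ (fun Y hY => hmaps Y hY) hinj
  have hterm : ∀ T ∈ F, fatTerm j (if (G \ insert z B).card - j ≤ 3 then 1 else 11 / 18) ≤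
      capS M 5 G T / ((221 / 360 : ℚ) * ((2 * ((T \ coloops M G).card - 2).choose 4 : ℕ) : ℚ)) := by
    intro T hT
    rw [hF, Finset.mem_filter, Finset.mem_filter] at hT
    obtain ⟨⟨hTt, -, -⟩, hTj⟩ := hT
    have hTG : T ⊆ G := subset_G_of_mem_shadowAt (mem_tgtSets.1 hTt).1
    have hTK : (T \ coloops M G).card = j + 5 := by
      rw [card_sdiff_coloops_eq_level_add_five hG hd hk hB hnP hz hTt, hTj]
    have hGT := card_sdiff_add_card_sdiff_of_mem_tgtSets hTt
    unfold fatTerm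
    rw [hTK, show j + 5 - 2 = j + 3 by omega]
    apply div_le_div_of_nonneg_right _ (by positivity)
    split_ifs with h3
    · rw [capS_eq_one_of_card_sdiff_le_three hd (by omega)]
    · exact capS_ge_eleven_eighteenths_two_one hd hk hTG
  have hpos : 0 ≤ fatTerm j (if (G \ insert z B).card - j ≤ 3 then 1 else 11 / 18) := by
    unfold fatTerm
    split_ifs <;> positivity
  calc (S.card : ℚ) * fatTerm j (if (G \ insert z B).card - j ≤ 3 then 1 else 11 / 18)
      ≤ (F.card : ℚ) * fatTerm j (if (G \ insert z B).card - j ≤ 3 then 1 else 11 / 18) := by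
        apply mul_le_mul_of_nonneg_right _ hpos
        exact_mod_cast hcount
    _ = ∑ _T ∈ F, fatTerm j (if (G \ insert z B).card - j ≤ 3 then 1 else 11 / 18) := by
        rw [Finset.sum_const, nsmul_eq_mul]
    _ ≤ _ := Finset.sum_le_sum (fun T hT => hterm T hT)

/-- **The numerics of `N = 7`**: one point of `W ∖ {x}` in each plane off the spine and four off the spine in all give
`≥ 3` cross pairs and `≥ 9` cross triples, and `110/221 + 3·(110/221)/15 + 9·(180/221)/35 + 15·(180/221)/70 +
6·(180/221)/126 + (180/221)/210 = 1.024`. -/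
theorem fat_count_numeric_seven_cross (a b s₂ s₃ : ℕ) (ha : 1 ≤ a) (hb : 1 ≤ b) (hab : 4 ≤ a + b) (hab6 : a + b ≤ 6)
    (hs₂ : (6 : ℕ).choose 2 + (6 - a - b).choose 2 ≤ s₂ + (6 - a).choose 2 + (6 - b).choose 2)
    (hs₃ : (6 : ℕ).choose 3 + (6 - a - b).choose 3 ≤ s₃ + (6 - a).choose 3 + (6 - b).choose 3) :
    (1 : ℚ) ≤ fatTerm 1 (11 / 18) + ((s₂ : ℚ) * fatTerm 3 (11 / 18) + (s₃ : ℚ) * fatTerm 4 1 +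
      (((7 - 1).choose (5 - 1) : ℕ) : ℚ) * fatTerm 5 1 + (((7 - 1).choose (6 - 1) : ℕ) : ℚ) * fatTerm 6 1 +
      (((7 - 1).choose (7 - 1) : ℕ) : ℚ) * fatTerm 7 1) := by
  have h2 : 3 ≤ s₂ := by
    have ha5 : a ≤ 5 := by omega
    have hb5 : b ≤ 5 := by omega
    interval_cases a <;> interval_cases b <;> simp_all [Nat.choose] <;> omega
  have h3 : 9 ≤ s₃ := by
    have ha5 : a ≤ 5 := by omega
    have hb5 : b ≤ 5 := by omega
    interval_cases a <;> interval_cases b <;> simp_all [Nat.choose] <;> omega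
  have h2' : (3 : ℚ) ≤ s₂ := by exact_mod_cast h2
  have h3' : (9 : ℚ) ≤ s₃ := by exact_mod_cast h3
  have hp3 : (0 : ℚ) ≤ fatTerm 3 (11 / 18) := by unfold fatTerm; positivity
  have hp4 : (0 : ℚ) ≤ fatTerm 4 1 := by unfold fatTerm; positivity
  have hnum : (1 : ℚ) ≤ fatTerm 1 (11 / 18) + (3 * fatTerm 3 (11 / 18) + 9 * fatTerm 4 1 +
      (((7 - 1).choose (5 - 1) : ℕ) : ℚ) * fatTerm 5 1 + (((7 - 1).choose (6 - 1) : ℕ) : ℚ) * fatTerm 6 1 +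
      (((7 - 1).choose (7 - 1) : ℕ) : ℚ) * fatTerm 7 1) := by
    unfold fatTerm
    norm_num [Nat.choose]
  nlinarith [mul_le_mul_of_nonneg_right h2' hp3, mul_le_mul_of_nonneg_right h3' hp4]

/-- **The fat case of (FAIR) in the non-degenerate two-planes regime at `N = 7`** with a spine of at most four points,
a point of `W ∖ {x}` in each plane off the spine and four points off the spine in all. -/
theorem basis_pair_fair_fat_of_two_planes_seven (hG : G ∈ flatsQ M (5 + 1)) (hd : (gr M \ G).card = 2)
    (hk : kColoops M G = 1) (hs : ∀ e ∈ gr M, ∀ f ∈ gr M, e ≠ f → rkN M {e, f} = 2)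
    (hl : ∀ e ∈ gr M, M.Indep {e}) (hfat : (fatClosures M 5 G 2).card ≤ 1)
    {B₀ : Finset α} (hB₀ : B₀ ∈ thinMembers M 5 G) {w₀ x : α} (hD : G \ clF M B₀ = {w₀, x}) (hne : w₀ ≠ x) {R₁ : Finset α}
    (hR₁V : R₁ ⊆ (G \ coloops M G) \ {w₀, x}) (hR₁2 : rkN M R₁ = 2) (hR₁3 : 3 ≤ R₁.card) {c₂ c₃ : α}
    (hc₂V : c₂ ∈ (G \ coloops M G) \ {w₀, x}) (hc₃V : c₃ ∈ (G \ coloops M G) \ {w₀, x})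
    (hc₂ : c₂ ∉ clF M R₁) (hc₃ : c₃ ∉ clF M (insert c₂ R₁))
    (hcover : ∀ e ∈ (G \ coloops M G) \ {w₀, x}, e ∈ clF M (insert c₂ R₁) ∨ e ∈ clF M (insert c₃ R₁))
    (hnd₂ : 3 ≤ rkN M (((G \ coloops M G) \ {w₀, x}).filter
      (fun e => e ∈ clF M (insert c₂ R₁) ∧ e ∉ clF M R₁)))
    (hnd₃ : 3 ≤ rkN M (((G \ coloops M G) \ {w₀, x}).filter
      (fun e => e ∈ clF M (insert c₃ R₁) ∧ e ∉ clF M R₁)))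
    (hL4 : (((G \ coloops M G) \ {w₀, x}).filter (fun e => e ∈ clF M R₁)).card ≤ 4)
    {B : Finset α} (hB : B ∈ thinMembers M 5 G) (hnP : ¬ bigP M G B) {z : α} (hz : z ∈ G \ clF M B)
    (hl0 : loss M 5 G B z ≠ 0) (hw₀ : w₀ ∈ insert z B) (hx : x ∉ insert z B) (hN : (G \ insert z B).card = 7)
    (hA : 1 ≤ (((G \ insert z B).erase x).filter (fun e => e ∈ clF M (insert c₂ R₁) ∧ e ∉ clF M R₁)).card)
    (hBp : 1 ≤ (((G \ insert z B).erase x).filter (fun e => e ∈ clF M (insert c₃ R₁) ∧ e ∉ clF M R₁)).card)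
    (hAB : 4 ≤ (((G \ insert z B).erase x).filter (fun e => e ∈ clF M (insert c₂ R₁) ∧ e ∉ clF M R₁)).card +
      (((G \ insert z B).erase x).filter (fun e => e ∈ clF M (insert c₃ R₁) ∧ e ∉ clF M R₁)).card) :
    loss M 5 G B z ≤ rhoL M 5 G B z * lossIncomeH M 5 G (bigP M G) (dshGT2 M 5 G) B z := by
  have hd' : (gr M \ G).card ≤ 5 := by omega
  have hGg : G ⊆ gr M := (mem_flatsQ.1 hG).1
  have hxG : x ∈ G \ insert z B := by
    refine Finset.mem_sdiff.2 ⟨?_, hx⟩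
    have : x ∈ G \ clF M B₀ := by
      rw [hD]
      exact Finset.mem_insert_of_mem (Finset.mem_singleton_self _)
    exact (Finset.mem_sdiff.1 this).1
  set W' := (G \ insert z B).erase x with hW'
  set A := W'.filter (fun e => e ∈ clF M (insert c₂ R₁) ∧ e ∉ clF M R₁) with hA'
  set Bp := W'.filter (fun e => e ∈ clF M (insert c₃ R₁) ∧ e ∉ clF M R₁) with hBp'
  have hm : W'.card = 6 := by
    rw [hW', Finset.card_erase_of_mem hxG, hN]
  have hR₁g : R₁ ⊆ gr M := hR₁V.trans (fun e he => hGg (Finset.mem_sdiff.1 (Finset.mem_sdiff.1 he).1).1)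
  have hc₂g : c₂ ∈ gr M := hGg (Finset.mem_sdiff.1 (Finset.mem_sdiff.1 hc₂V).1).1
  have hc₃g : c₃ ∈ gr M := hGg (Finset.mem_sdiff.1 (Finset.mem_sdiff.1 hc₃V).1).1
  have hdisj : Disjoint A Bp := by
    rw [Finset.disjoint_left]
    intro e heA heB
    rw [hA', Finset.mem_filter] at heA
    rw [hBp', Finset.mem_filter] at heB
    exact heA.2.2 (mem_clF_of_mem_two_planes hR₁g hc₂g hc₃g hc₂ hc₃ heA.2.1 heB.2.1)
  have hAW : A ⊆ W' := Finset.filter_subset _ _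
  have hBW : Bp ⊆ W' := Finset.filter_subset _ _
  have hcA : (W' \ A).card = 6 - A.card := by rw [Finset.card_sdiff_of_subset hAW, hm]
  have hcB : (W' \ Bp).card = 6 - Bp.card := by rw [Finset.card_sdiff_of_subset hBW, hm]
  have hcAB : (W' \ (A ∪ Bp)).card = 6 - A.card - Bp.card := by
    rw [Finset.card_sdiff_of_subset (Finset.union_subset hAW hBW), Finset.card_union_of_disjoint hdisj, hm]
    omega
  have hAB6 : A.card + Bp.card ≤ 6 := by
    have := Finset.card_le_card (Finset.union_subset hAW hBW)
    rw [Finset.card_union_of_disjoint hdisj, hm] at this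
    exact this
  -- the top levels `5, 6, 7` are unloaded: the spine carries at most four points
  have htop : ∀ T ∈ tgtSets M 5 G B z, x ∈ T → 5 ≤ (T \ insert z B).card →
      dload M 5 G (bigP M G) (dshGT2 M 5 G) T = 0 := by
    intro T hT _ h5
    have hTG : T ⊆ G := subset_G_of_mem_shadowAt (mem_tgtSets.1 hT).1
    have hGT := card_sdiff_add_card_sdiff_of_mem_tgtSets hT
    have hsub : ((T \ coloops M G) \ {w₀, x}).filter (fun e => e ∈ clF M R₁) ⊆
        ((G \ coloops M G) \ {w₀, x}).filter (fun e => e ∈ clF M R₁) :=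
      Finset.filter_subset_filter _
        (Finset.sdiff_subset_sdiff (Finset.sdiff_subset_sdiff hTG (Finset.Subset.refl _)) (Finset.Subset.refl _))
    have := Finset.card_le_card hsub
    exact dload_eq_zero_of_top_of_spine_le hG hd hk hs hl hfat hB₀ hD hR₁V hR₁2 hR₁3 hc₂V hc₃V hc₂ hc₃ hcover
      hnd₂ hnd₃ hB hnP hz hT (by omega) (by omega)
  have hl1 := fat_count_level_ge' hG hd hk hB hnP hz hxG (j := 1) (by norm_num)
    (fun T hT _ h1 => dload_eq_zero_of_card_sdiff_le_six hG hd hk hs hl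
      (by rw [card_sdiff_coloops_eq_level_add_five hG hd hk hB hnP hz hT, h1]))
  have hl5 := fat_count_level_ge' hG hd hk hB hnP hz hxG (j := 5) (by norm_num)
    (fun T hT hxT h5 => htop T hT hxT (by omega))
  have hl6 := fat_count_level_ge' hG hd hk hB hnP hz hxG (j := 6) (by norm_num)
    (fun T hT hxT h6 => htop T hT hxT (by omega))
  have hl7 := fat_count_level_ge' hG hd hk hB hnP hz hxG (j := 7) (by norm_num)
    (fun T hT hxT h7 => htop T hT hxT (by omega))
  have hl3 := fat_count_level_ge_cross hG hd hk hs hl hfat hB₀ hD hR₁V hR₁2 hR₁3 hc₂V hc₃V hc₂ hc₃ hcover hnd₂ hnd₃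
    hB hnP hz hxG (j := 3) (by norm_num)
  have hl4 := fat_count_level_ge_cross hG hd hk hs hl hfat hB₀ hD hR₁V hR₁2 hR₁3 hc₂V hc₃V hc₂ hc₃ hcover hnd₂ hnd₃
    hB hnP hz hxG (j := 4) (by norm_num)
  rw [← hW', ← hA', ← hBp'] at hl3 hl4
  rw [hN] at hl1 hl3 hl4 hl5 hl6 hl7
  have hS2 := choose_le_card_filter_meets_both W' A Bp (3 - 1)
  have hS3 := choose_le_card_filter_meets_both W' A Bp (4 - 1)
  rw [hm, hcA, hcB, hcAB] at hS2 hS3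
  have hnum := fat_count_numeric_seven_cross A.card Bp.card _ _ hA hBp hAB hAB6 hS2 hS3
  have hc1 : (if 7 - 1 ≤ 3 then (1 : ℚ) else 11 / 18) = 11 / 18 := by rw [if_neg (by omega)]
  have hc3 : (if 7 - 3 ≤ 3 then (1 : ℚ) else 11 / 18) = 11 / 18 := by rw [if_neg (by omega)]
  have hc4 : (if 7 - 4 ≤ 3 then (1 : ℚ) else 11 / 18) = 1 := by rw [if_pos (by omega)]
  have hc5 : (if 7 - 5 ≤ 3 then (1 : ℚ) else 11 / 18) = 1 := by rw [if_pos (by omega)]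
  have hc6 : (if 7 - 6 ≤ 3 then (1 : ℚ) else 11 / 18) = 1 := by rw [if_pos (by omega)]
  have hc7 : (if 7 - 7 ≤ 3 then (1 : ℚ) else 11 / 18) = 1 := by rw [if_pos (by omega)]
  rw [hc1] at hl1
  rw [hc3] at hl3
  rw [hc4] at hl4
  rw [hc5] at hl5
  rw [hc6] at hl6
  rw [hc7] at hl7
  simp only [Nat.sub_self, Nat.choose_zero_right, Nat.cast_one, one_mul] at hl1
  have hg0 : ∀ T ∈ (tgtSets M 5 G B z).filter
      (fun T => x ∈ T ∧ dload M 5 G (bigP M G) (dshGT2 M 5 G) T = 0),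
      0 ≤ capS M 5 G T / ((221 / 360 : ℚ) * ((2 * ((T \ coloops M G).card - 2).choose 4 : ℕ) : ℚ)) :=
    fun T _ => div_nonneg (capS_nonneg' hG hd' T) (by positivity)
  apply basis_pair_fair_of_fat_count_sum hG hd hk hs hl hfat hB₀ hD hne hB hnP hz hl0 hw₀ hx
  have hsum := sum_levels_le_sum hg0 (fun T => (T \ insert z B).card) {1, 3, 4, 5, 6, 7}
  rw [Finset.sum_insert (by decide), Finset.sum_insert (by decide), Finset.sum_insert (by decide),
    Finset.sum_insert (by decide), Finset.sum_insert (by decide), Finset.sum_singleton] at hsum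
  linarith

end PercRepro.Shadow
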